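import Mathlib
import Summits.QuantumAdvantage.Dequantization.GalerkinDuality

/-!
# Galerkin energy-norm optimality (matrix Céa lemma; DEQ-A238)

HONEST FRAMING: instance-level adjudication of specific advantage claims; no claim about
BQP vs BPP or the summit.

Lane receipt written by unit pub-qadeq-deq-1 (gen 37); staging copy
`pub-qadeq-deq-1/GalerkinEnergyOptimality.lean`, to be filed through the gate by the cell lead.

Context (cell pub-qadeq, claim A-238 = Ichiki et al., "Problem-Specific Basis Quantum State Readout via
Proper Orthogonal Decomposition", arXiv:2605.27915v1): the paper reads out, by `O(n_b² / ε²)` Hadamard tests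
on fresh outputs of a quantum full-order solver, the coefficients `Pᵀ c` of the solution `c` of `S c = r` in a
precomputed POD basis (the columns of `P`).  DEQ-A238.md prices the classical alternative on the same basis:
the POD–Galerkin reduced-order model solves the `k × k` system `(Pᵀ S P) c_H = Pᵀ r` and, for symmetric
positive semidefinite `S`, its error is optimal in the energy norm over the whole coarse space — in particular
it is at most the energy-norm error of the POD projection `P (Pᵀ c)` whose coefficients the paper estimates
(Quarteroni, *Numerical Models for Differential Problems*, 2nd ed., (19.32); Rozza–Huynh–Patera 2008, (65)).

* `energy_optimality` : `(c - P c_H) ⬝ S (c - P c_H) ≤ (c - P y) ⬝ S (c - P y)` for every coarse `y`;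
* `energy_le_pod_projection` : the case `y = Pᵀ c`.

`[folklore]` linear algebra (Galerkin orthogonality, reused BY NAME from `GalerkinDuality`, plus positivity of
the form on the in-space correction).  Mathlib-only apart from that import, no `def`, no named fact, no `sorry`.
-/

namespace Summit.QuantumAdvantage.Dequantization.GalerkinEnergyOptimality

open Matrix

variable {n k : Type*} [Fintype n] [Fintype k]

/-- **Matrix Céa lemma.** For a symmetric positive semidefinite `S`, a fine solution `S c = r` and the
Galerkin solution `c_H` of `(Pᵀ S P) c_H = Pᵀ r`, the energy of the Galerkin error is minimal over the
coarse space: `(c - P c_H) ⬝ S (c - P c_H) ≤ (c - P y) ⬝ S (c - P y)` for every `y`. [folklore] -/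
theorem energy_optimality {S : Matrix n n ℝ} (hS : S.IsSymm) (hpsd : ∀ e, 0 ≤ e ⬝ᵥ S *ᵥ e)
    (P : Matrix n k ℝ) {r c : n → ℝ} {cH : k → ℝ}
    (hc : S *ᵥ c = r) (hcH : (Pᵀ * S * P) *ᵥ cH = Pᵀ *ᵥ r) (y : k → ℝ) :
    (c - P *ᵥ cH) ⬝ᵥ S *ᵥ (c - P *ᵥ cH) ≤ (c - P *ᵥ y) ⬝ᵥ S *ᵥ (c - P *ᵥ y) := by
  have horth : Pᵀ *ᵥ (S *ᵥ (c - P *ᵥ cH)) = 0 :=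
    GalerkinDuality.galerkin_orthogonality S P hc hcH
  have hsplit : c - P *ᵥ y = (c - P *ᵥ cH) + P *ᵥ (cH - y) := by
    rw [mulVec_sub]; abel
  have hcross : (P *ᵥ (cH - y)) ⬝ᵥ S *ᵥ (c - P *ᵥ cH) = 0 := by
    rw [GalerkinDuality.mulVec_dotProduct_eq_dotProduct_transpose_mulVec, horth, dotProduct_zero]
  have hcross' : (c - P *ᵥ cH) ⬝ᵥ S *ᵥ (P *ᵥ (cH - y)) = 0 := by
    rw [GalerkinDuality.dotProduct_mulVec_of_isSymm hS, dotProduct_comm, hcross]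
  have hpd := hpsd (P *ᵥ (cH - y))
  rw [hsplit, mulVec_add, add_dotProduct, dotProduct_add, dotProduct_add, hcross, hcross']
  linarith

/-- The Galerkin (reduced-order-model) error is at most the POD-projection error in the energy norm:
take `y = Pᵀ c`, the exact expansion coefficients of the fine solution in the reduced basis (the quantities a
basis readout estimates). [folklore] -/
theorem energy_le_pod_projection {S : Matrix n n ℝ} (hS : S.IsSymm) (hpsd : ∀ e, 0 ≤ e ⬝ᵥ S *ᵥ e)
    (P : Matrix n k ℝ) {r c : n → ℝ} {cH : k → ℝ}
    (hc : S *ᵥ c = r) (hcH : (Pᵀ * S * P) *ᵥ cH = Pᵀ *ᵥ r) :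
    (c - P *ᵥ cH) ⬝ᵥ S *ᵥ (c - P *ᵥ cH) ≤ (c - P *ᵥ (Pᵀ *ᵥ c)) ⬝ᵥ S *ᵥ (c - P *ᵥ (Pᵀ *ᵥ c)) :=
  energy_optimality hS hpsd P hc hcH (Pᵀ *ᵥ c)

end Summit.QuantumAdvantage.Dequantization.GalerkinEnergyOptimality
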